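import Summits.QuantumFields.YangMills.Theorems.BalabanUVNodesK0V23Defs
import Summits.QuantumFields.YangMills.Theorems.BalabanUVNodesN07Prop8StepCoPGridGAtLam
import HarnessLib

/-!
# K0⁷ V23 — STUB 1ᴮ HOLDS: `K0V23Defs.Prop8StepCoPGridGBAt F` for every `F : T4Family` (the V23 stub-1 text — [15] Prop. 8's grid-guarded top step over print's [II] (2.3) datum
# `lamDatum F` and print's (7) data `dataSmall7LamTopOf F 2` — is the S1c chain's end-to-end theorem `exists_prop8RegSepTopStepGB_lam F 1 le_rfl`, ✓p767364)

Cell `pub-ymgap`, seat `pub-ymgap-dag-n07-e` g34 (FAN-OUT §N07 row s3; LANE OWNER of the K0 road chart side).  `--kind proof --supports stmt-QuantumFields-20541 --as helper` (K0⁷); count-neutral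
until the V23 skeleton is REGISTERED (№281 procedure; plan g96's `K0Skeleton13SepCoPHV23.stub_prop8StepCoPGridGB13 : ∀ F, K0V23Defs.Prop8StepCoPGridGBAt F` is the target this theorem
has the type of).  [15] = [Balaban1985Variational]; [6] = [Balaban1985RegularSpaces]; [II] = [Balaban1984PropagatorsII]; [III] = [Balaban1988Convergent].

WHAT IS PROVED (sorry-free; no definition; axioms standard).  ★★★★ `prop8StepCoPGridGBAt_holds (F) : K0V23Defs.Prop8StepCoPGridGBAt F` — by `exists_prop8RegSepTopStepGB_lam F 1 le_rfl`
(`…N07Prop8StepCoPGridGAtLam`, ✓p767364: grid side `Mc := 1`; the text's body is that theorem's statement verbatim, plan g96 INTENT-V23DEFS ad2c77ad71c282ec §1), and the `∀ F` form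
`prop8StepCoPGridGBAt_holds_all : ∀ F, K0V23Defs.Prop8StepCoPGridGBAt F` (the door `k0Body_of_stub1B_of_2P_of_3B`'s `h1` binder shape).
ROAD (by name; all landed): dag-n05-e's record crown `recordCrownSUPrecomp_holds_of_le F 2` (N ≤ 25) → ✓140 thm 1 `sym152PhiEG_uniform_of_recordCrown` ((P1-G), the junction) → 125′ §1
(K0 witness, collar letter, grid guard) → 124′ (MODULE 118 numerics) → 123′ ((c′) 99″ᴮ from the print-datum near-row readers C2; (d′)-Lam 117′ᴮ) → 122′ (77c⁵′ᴮ knit WITHOUT the seam +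
S1c-1 door + 89⁵′ + `K0HalvingStepOfCoreB` core-to-top link at `Ex0 := lamPlaqs0Of F`) → F0c's token `Prop8RegSepTopStepGB … (lamDatum F) (dataSmall7LamTopOf F 2)`.
HONEST SCOPE (binding).  A one-line instantiation; its content is the S1c chain's (desk memo `S1C-CHAIN-MAP.md`).  It has the TYPE of the V23 stub-1 target but CLOSES NOTHING until the
plan seat registers V23 and the item is released `--by` this name (a ledger act, not this file's); the (b)-datum V22-Z stub 1 `K0V22ZDefs.Prop8StepCoPGridGAt` stays OPEN (its road needs the
uninhabited HSEAM, `not_hseam` ✓p765776) and is retired by V23, not refuted.  Nothing of [15]∕[6]∕[II]∕[III] asserted anew; K0⁷ NOT closed by this file (stub 3ᴬ′ᴮ and the seam `hseam` remain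
on K0⁷'s body); N07 NOT discharged (chair∕referee); counts unmoved (typed 28∕28 · discharged 8∕28); one finite 𝕋⁴ programme at fixed ε — the route closes the conditional finite-𝕋⁴ rung
`BalabanLadder.UV` ONLY; the YM mass gap (Clay) is NOT proved by any of this; nothing continuum ∕ ℝ⁴ ∕ OS.  No `def`, no `instance`, no `notation`, no `sorry`.

References: [15] Prop. 8 p. 304, (7) p. 278, (144) p. 300, (147)–(163) pp. 301–304; [6] Thm. 4 p. 88, Prop. 6 (1.130)–(1.138) p. 99, Prop. 8 p. 100; [II] (2.3) p. 224; [III] (2.1) p. 254,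
(2.5) p. 255, (2.10) p. 256.
-/

set_option autoImplicit false

noncomputable section

namespace Summit.QuantumFields.YangMills.BalabanUVNodes.K0Stub1BHolds

open Literature.MathematicalPhysics.QuantumFieldTheory.Balaban1983to89
open T4Continuum (T4Family)
open Summit.QuantumFields.YangMills.Theorems.K0V23Defs (Prop8StepCoPGridGBAt)
open Summit.QuantumFields.YangMills.BalabanUVNodes.N07Prop8StepCoPGridGAtLam (exists_prop8RegSepTopStepGB_lam)

/-- ★★★★ **THE V23 STUB-1 TEXT HOLDS**: `K0V23Defs.Prop8StepCoPGridGBAt F` — [15] Proposition 8's grid-guarded top step over print's [II] (2.3) datum and print's (7) data, for `N = 2` —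
by the S1c chain's end-to-end theorem at grid side `Mc := 1`. [cite: Balaban1985Variational, Prop. 8 p.304, (7) p.278, (147)–(163) pp.301–304; Balaban1985RegularSpaces, Thm. 4 p.88, Prop. 6 (1.130)–(1.138) p.99, Prop. 8 p.100; Balaban1984PropagatorsII, (2.3) p.224; Balaban1988Convergent, (2.5) p.255, (2.10) p.256] -/
theorem prop8StepCoPGridGBAt_holds (F : T4Family) : Prop8StepCoPGridGBAt F :=
  exists_prop8RegSepTopStepGB_lam F 1 le_rfl

/-- The `∀ F` form — the `h1` binder of `K0V23Defs.k0Body_of_stub1B_of_2P_of_3B` and the type of the V23 skeleton's `stub_prop8StepCoPGridGB13`. [cite: Balaban1985Variational, Prop. 8 p.304; Balaban1988Convergent, (2.5) p.255] -/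
theorem prop8StepCoPGridGBAt_holds_all : ∀ F : T4Family, Prop8StepCoPGridGBAt F :=
  fun F => prop8StepCoPGridGBAt_holds F

end Summit.QuantumFields.YangMills.BalabanUVNodes.K0Stub1BHolds

end
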